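import Mathlib
import Summits.ValiantsHypothesis.ValiantsHypothesis.Theses.ValuativeGCT
import Summits.ValiantsHypothesis.ValiantsHypothesis.Theorems.ValuativeGCTNoValuativeFlipUnconditional
import Summits.ValiantsHypothesis.ValiantsHypothesis.Theorems.ValuativeGCTNoValuativeFlipOutsideKL
import Summits.ValiantsHypothesis.ValiantsHypothesis.Theorems.ValuativeGCTValuativeFlipBinaryFormsDeterminantal

/-!
# `HeadFlip` (stmt-ValiantsHypothesis-15535) — negative lemmas: the shape of a flip witness

Route `ValuativeGCT`, crux `HeadFlip` (linear head of `ValuativeFlip`).  Standing disprover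
(cdisprove, cycle 1), `Cruxes/HeadFlip/Disproof.lean` §WitnessShape, def-free.  At any position
`n ≤ m` of the head window, a witness `(U, r, δ, λ)` of the flip body (verbatim the route decl's
`let χ …; let T …; dim T < mult`) is constrained as follows — natural strengthenings of the crux
("flip on a two-row shape", "flip in degree 0", "flip off the Kadish–Landsberg cone", "flip at or
beyond Grenet") are thereby REFUTED:

* `headFlip_witness_three_le_card_parts` — `3 ≤ ℓ(λ)`: the dual weight of a partition with at most
  two parts lives on the last two lexicographic letters, and on two letters `Det_m` majorises every
  orbit closure (binary forms are products of linear forms; landed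
  `ValuativeFlip.orbitMultiplicity_le_det_of_card_le_two`), while `K_m(λ*) ≤ dim T_U(λ)`
  (`ValuativeBound_proof`).  (Informally `4 ≤ ℓ(λ)` by Dixon–Beauville: every ternary form is a
  limit of determinantal ones; not formalised.)
* `headFlip_witness_delta_pos` — hence `0 < δ`.
* `headFlip_witness_kadishLandsberg` — `δ (m - n) ≤ λ₁` and `ℓ(λ) ≤ n² + 1` (landed
  `NoValuativeFlip.kadishLandsberg_of_hasHighestWeight_paddedPerOrbitRep` = Kadish–Landsberg 2014 /
  BIP 2019 Thm 4.9, applied to the occurrence `0 < mult_pp(λ*)` forced by the strict inequality).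
* `headFlip_witness_lt_two_pow` — `m + 1 < 2ⁿ` (beyond Grenet nothing flips, landed
  `NoValuativeFlip.noValuativeFlip_body_of_two_pow_le'`).

Sources: H. Kadish, J. M. Landsberg, Comm. Algebra 42 (2014); P. Bürgisser, C. Ikenmeyer,
G. Panova, J. AMS 32 (2019) Thm 4.9; A. Beauville, Michigan Math. J. 48 (2000); BLMW 2011 §5.3;
this route.
-/

-- `Summit.ValiantsHypothesis.ValiantsHypothesis.…` repeats a component by the D-0017 layout
-- (single-conjunct summit), which the `dupNamespace` linter flags; the name is mandated.
set_option linter.dupNamespace false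

noncomputable section

namespace Summit.ValiantsHypothesis.ValiantsHypothesis.Theorems.HeadFlip.Negative

open Literature.NumberTheory.DiophantineGeometry Literature.Computability.AlgebraicComplexity
open Summit.ValiantsHypothesis.ValiantsHypothesis.Theses.ValuativeGCT
open Summit.ValiantsHypothesis.ValiantsHypothesis.Theorems
open MvPolynomial

/-- **Flip witnesses have at least three rows** (any `n ≤ m`, any centre): for `λ` with at most two
parts the flip inequality fails, because `mult_λ* ℂ[Δ_m(X₀₀^(m-n) per_n)] ≤ K_m(λ*) ≤ dim T_U(λ)`
(two-letter majorisation by `Det_m`, then the valuative bound). [BLMW 2011 §5.3; this route] -/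
theorem headFlip_witness_three_le_card_parts {n : ℕ} (m : ℕ) [NeZero m] (hnm : n ≤ m)
    (U : Submodule ℂ (Literature.NumberTheory.DiophantineGeometry.MatIdx m → ℂ)) (r : ℕ)
    (hU : ∀ u ∈ U, (Matrix.of fun a b : Fin m => u (toLex (a, b))).rank ≤ r)
    (δ : ℕ) (lam : Nat.Partition (m * δ)) (hcard : lam.parts.card ≤ m * m)
    (hlt : let χ : Literature.NumberTheory.DiophantineGeometry.Weight (Literature.NumberTheory.DiophantineGeometry.MatIdx m) := (Literature.NumberTheory.DiophantineGeometry.Weight.dualOfPartition (m * m) lam).toMatIdx; let T : Submodule ℂ (MvPolynomial (Literature.NumberTheory.DiophantineGeometry.MatIdx m × Literature.NumberTheory.DiophantineGeometry.MatIdx m) ℂ) := MvPolynomial.homogeneousSubmodule (Literature.NumberTheory.DiophantineGeometry.MatIdx m × Literature.NumberTheory.DiophantineGeometry.MatIdx m) ℂ (m * δ) ⊓ ((MvPolynomial.vanishingIdeal ℂ {p : Literature.NumberTheory.DiophantineGeometry.MatIdx m × Literature.NumberTheory.DiophantineGeometry.MatIdx m → ℂ | ∀ j : Literature.NumberTheory.DiophantineGeometry.MatIdx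 m, (fun i => p (j, i)) ∈ U}) ^ (δ * (m - r))).restrictScalars ℂ ⊓ (⨅ (M : Matrix (Literature.NumberTheory.DiophantineGeometry.MatIdx m) (Literature.NumberTheory.DiophantineGeometry.MatIdx m) ℂ) (_ : Literature.Computability.AlgebraicComplexity.linSubst (Literature.NumberTheory.DiophantineGeometry.MatIdx m) ℂ M (Literature.NumberTheory.DiophantineGeometry.detFormLex ℂ m) = Literature.NumberTheory.DiophantineGeometry.detFormLex ℂ m), LinearMap.ker ((MvPolynomial.aeval (R := ℂ) fun p : Literature.NumberTheory.DiophantineGeometry.MatIdx m × Literature.NumberTheory.DiophantineGeometry.MatIdx m => ∑ l : Literature.NumberTheory.DiophantineGeometry.MatIdx m, M l p.2 • MvPolynomial.X (p.1, l)).toLinearMap - LinearMap.id (R := ℂ) (M := MvPolynomial (Literature.NumberTheory.DiophantineGeometry.MatIdx m × Literature.NumberTheory.DiophantineGeometry.MatIdx m) ℂ))) ⊓ (⨅ (g : Matrix.GeneralLinearGroup (Literature.NumberTheory.DiophantineGeometry.MatIdx m) ℂ) (_ : Literature.NumberTheory.DiophantineGeometry.IsUpperTriangular g), LinearMap.ker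 ((MvPolynomial.aeval (R := ℂ) fun p : Literature.NumberTheory.DiophantineGeometry.MatIdx m × Literature.NumberTheory.DiophantineGeometry.MatIdx m => ∑ l : Literature.NumberTheory.DiophantineGeometry.MatIdx m, ((g⁻¹ : Matrix.GeneralLinearGroup (Literature.NumberTheory.DiophantineGeometry.MatIdx m) ℂ) : Matrix (Literature.NumberTheory.DiophantineGeometry.MatIdx m) (Literature.NumberTheory.DiophantineGeometry.MatIdx m) ℂ) p.1 l • MvPolynomial.X (l, p.2)).toLinearMap - Literature.NumberTheory.DiophantineGeometry.weightChar χ g • LinearMap.id (R := ℂ) (M := MvPolynomial (Literature.NumberTheory.DiophantineGeometry.MatIdx m × Literature.NumberTheory.DiophantineGeometry.MatIdx m) ℂ))); Module.finrank ℂ ↥T < Literature.NumberTheory.DiophantineGeometry.orbitMultiplicity ℂ (Literature.NumberTheory.DiophantineGeometry.paddedPerFormLex ℂ n m) m χ) :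
    3 ≤ lam.parts.card := by
  classical
  by_contra h3
  set ρ := lam.parts.card with hρ
  have hρ2 : ρ ≤ 2 := by omega
  have hmpos : 0 < m := NeZero.pos m
  have hmm : 1 ≤ m * m := Nat.one_le_iff_ne_zero.mpr (Nat.mul_ne_zero hmpos.ne' hmpos.ne')
  -- the last `ρ` lexicographic positions
  let S : Finset (MatIdx m) := Finset.univ.image fun t : Fin ρ =>
    matIdxEquiv m ⟨m * m - 1 - t, by omega⟩
  have hScard : S.card ≤ 2 := Finset.card_image_le.trans (by simpa using hρ2)
  have hχ : ∀ i, i ∉ S → (Weight.dualOfPartition (m * m) lam).toMatIdx i = 0 := by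
    intro i hi
    obtain ⟨i', rfl⟩ : ∃ i' : Fin (m * m), matIdxEquiv m i' = i :=
      ⟨(matIdxEquiv m).symm i, (matIdxEquiv m).apply_symm_apply i⟩
    by_cases hlt' : (i' : ℕ) + ρ < m * m
    · exact NoValuativeFlip.dualOfPartition_toMatIdx_eq_zero_of_lt lam i' hlt'
    · exfalso
      apply hi
      refine Finset.mem_image.mpr ⟨⟨m * m - 1 - i', by omega⟩, Finset.mem_univ _, ?_⟩
      congr 1
      exact Fin.ext (by simp; omega)
  have hle := ValuativeFlip.orbitMultiplicity_le_det_of_card_le_two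
    (paddedPerFormLex_isHomogeneous ℂ hnm) S hScard _ hχ
  exact (not_lt.mpr (hle.trans (ValuativeBound.ValuativeBound_proof m U r hU δ lam hcard))) hlt

/-- **Flip witnesses have positive degree** (`δ = 0`: the partition of `0` has no parts, but a
witness has at least three). -/
theorem headFlip_witness_delta_pos {n : ℕ} (m : ℕ) [NeZero m] (hnm : n ≤ m)
    (U : Submodule ℂ (Literature.NumberTheory.DiophantineGeometry.MatIdx m → ℂ)) (r : ℕ)
    (hU : ∀ u ∈ U, (Matrix.of fun a b : Fin m => u (toLex (a, b))).rank ≤ r)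
    (δ : ℕ) (lam : Nat.Partition (m * δ)) (hcard : lam.parts.card ≤ m * m)
    (hlt : let χ : Literature.NumberTheory.DiophantineGeometry.Weight (Literature.NumberTheory.DiophantineGeometry.MatIdx m) := (Literature.NumberTheory.DiophantineGeometry.Weight.dualOfPartition (m * m) lam).toMatIdx; let T : Submodule ℂ (MvPolynomial (Literature.NumberTheory.DiophantineGeometry.MatIdx m × Literature.NumberTheory.DiophantineGeometry.MatIdx m) ℂ) := MvPolynomial.homogeneousSubmodule (Literature.NumberTheory.DiophantineGeometry.MatIdx m × Literature.NumberTheory.DiophantineGeometry.MatIdx m) ℂ (m * δ) ⊓ ((MvPolynomial.vanishingIdeal ℂ {p : Literature.NumberTheory.DiophantineGeometry.MatIdx m × Literature.NumberTheory.DiophantineGeometry.MatIdx m → ℂ | ∀ j : Literature.NumberTheory.DiophantineGeometry.MatIdx m, (fun i => p (j, i)) ∈ U}) ^ (δ * (m - r))).restrictScalars ℂ ⊓ (⨅ (M : Matrix (Literature.NumberTheory.DiophantineGeometry.MatIdx m) (Literature.NumberTheory.DiophantineGeometry.MatIdx m) ℂ) (_ : Literature.Computability.AlgebraicComplexity.linSubst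 (Literature.NumberTheory.DiophantineGeometry.MatIdx m) ℂ M (Literature.NumberTheory.DiophantineGeometry.detFormLex ℂ m) = Literature.NumberTheory.DiophantineGeometry.detFormLex ℂ m), LinearMap.ker ((MvPolynomial.aeval (R := ℂ) fun p : Literature.NumberTheory.DiophantineGeometry.MatIdx m × Literature.NumberTheory.DiophantineGeometry.MatIdx m => ∑ l : Literature.NumberTheory.DiophantineGeometry.MatIdx m, M l p.2 • MvPolynomial.X (p.1, l)).toLinearMap - LinearMap.id (R := ℂ) (M := MvPolynomial (Literature.NumberTheory.DiophantineGeometry.MatIdx m × Literature.NumberTheory.DiophantineGeometry.MatIdx m) ℂ))) ⊓ (⨅ (g : Matrix.GeneralLinearGroup (Literature.NumberTheory.DiophantineGeometry.MatIdx m) ℂ) (_ : Literature.NumberTheory.DiophantineGeometry.IsUpperTriangular g), LinearMap.ker ((MvPolynomial.aeval (R := ℂ) fun p : Literature.NumberTheory.DiophantineGeometry.MatIdx m × Literature.NumberTheory.DiophantineGeometry.MatIdx m => ∑ l : Literature.NumberTheory.DiophantineGeometry.MatIdx m, ((g⁻¹ : Matrix.GeneralLinearGroup (Literature.NumberTheory.DiophantineGeometry.MatIdx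 m) ℂ) : Matrix (Literature.NumberTheory.DiophantineGeometry.MatIdx m) (Literature.NumberTheory.DiophantineGeometry.MatIdx m) ℂ) p.1 l • MvPolynomial.X (l, p.2)).toLinearMap - Literature.NumberTheory.DiophantineGeometry.weightChar χ g • LinearMap.id (R := ℂ) (M := MvPolynomial (Literature.NumberTheory.DiophantineGeometry.MatIdx m × Literature.NumberTheory.DiophantineGeometry.MatIdx m) ℂ))); Module.finrank ℂ ↥T < Literature.NumberTheory.DiophantineGeometry.orbitMultiplicity ℂ (Literature.NumberTheory.DiophantineGeometry.paddedPerFormLex ℂ n m) m χ) :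
    0 < δ := by
  have h3 := headFlip_witness_three_le_card_parts m hnm U r hU δ lam hcard hlt
  by_contra hδ
  obtain rfl : δ = 0 := by omega
  have hsum : lam.parts.sum = 0 := lam.parts_sum.trans (Nat.mul_zero m)
  have : lam.parts = 0 := by
    by_contra hne
    obtain ⟨x, hx⟩ := Multiset.exists_mem_of_ne_zero hne
    have hxpos := lam.parts_pos hx
    have := Multiset.le_sum_of_mem hx
    omega
  rw [this, Multiset.card_zero] at h3
  omega

/-- **Flip witnesses are Kadish–Landsberg shapes**: `δ (m - n) ≤ λ₁` and `ℓ(λ) ≤ n² + 1`, since the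
strict inequality forces the occurrence `0 < mult_λ* ℂ[Δ_m(X₀₀^(m-n) per_n)]`.
[Kadish–Landsberg 2014; BIP 2019 Thm 4.9] -/
theorem headFlip_witness_kadishLandsberg {n : ℕ} (m : ℕ) [NeZero m] (hnm : n ≤ m)
    (U : Submodule ℂ (Literature.NumberTheory.DiophantineGeometry.MatIdx m → ℂ)) (r : ℕ)
    (δ : ℕ) (lam : Nat.Partition (m * δ)) (hcard : lam.parts.card ≤ m * m)
    (hlt : let χ : Literature.NumberTheory.DiophantineGeometry.Weight (Literature.NumberTheory.DiophantineGeometry.MatIdx m) := (Literature.NumberTheory.DiophantineGeometry.Weight.dualOfPartition (m * m) lam).toMatIdx; let T : Submodule ℂ (MvPolynomial (Literature.NumberTheory.DiophantineGeometry.MatIdx m × Literature.NumberTheory.DiophantineGeometry.MatIdx m) ℂ) := MvPolynomial.homogeneousSubmodule (Literature.NumberTheory.DiophantineGeometry.MatIdx m × Literature.NumberTheory.DiophantineGeometry.MatIdx m) ℂ (m * δ) ⊓ ((MvPolynomial.vanishingIdeal ℂ {p : Literature.NumberTheory.DiophantineGeometry.MatIdx m × Literature.NumberTheory.DiophantineGeometry.MatIdx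 m → ℂ | ∀ j : Literature.NumberTheory.DiophantineGeometry.MatIdx m, (fun i => p (j, i)) ∈ U}) ^ (δ * (m - r))).restrictScalars ℂ ⊓ (⨅ (M : Matrix (Literature.NumberTheory.DiophantineGeometry.MatIdx m) (Literature.NumberTheory.DiophantineGeometry.MatIdx m) ℂ) (_ : Literature.Computability.AlgebraicComplexity.linSubst (Literature.NumberTheory.DiophantineGeometry.MatIdx m) ℂ M (Literature.NumberTheory.DiophantineGeometry.detFormLex ℂ m) = Literature.NumberTheory.DiophantineGeometry.detFormLex ℂ m), LinearMap.ker ((MvPolynomial.aeval (R := ℂ) fun p : Literature.NumberTheory.DiophantineGeometry.MatIdx m × Literature.NumberTheory.DiophantineGeometry.MatIdx m => ∑ l : Literature.NumberTheory.DiophantineGeometry.MatIdx m, M l p.2 • MvPolynomial.X (p.1, l)).toLinearMap - LinearMap.id (R := ℂ) (M := MvPolynomial (Literature.NumberTheory.DiophantineGeometry.MatIdx m × Literature.NumberTheory.DiophantineGeometry.MatIdx m) ℂ))) ⊓ (⨅ (g : Matrix.GeneralLinearGroup (Literature.NumberTheory.DiophantineGeometry.MatIdx m) ℂ) (_ : Literature.NumberTheory.DiophantineGeometry.IsUpperTriangular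 g), LinearMap.ker ((MvPolynomial.aeval (R := ℂ) fun p : Literature.NumberTheory.DiophantineGeometry.MatIdx m × Literature.NumberTheory.DiophantineGeometry.MatIdx m => ∑ l : Literature.NumberTheory.DiophantineGeometry.MatIdx m, ((g⁻¹ : Matrix.GeneralLinearGroup (Literature.NumberTheory.DiophantineGeometry.MatIdx m) ℂ) : Matrix (Literature.NumberTheory.DiophantineGeometry.MatIdx m) (Literature.NumberTheory.DiophantineGeometry.MatIdx m) ℂ) p.1 l • MvPolynomial.X (l, p.2)).toLinearMap - Literature.NumberTheory.DiophantineGeometry.weightChar χ g • LinearMap.id (R := ℂ) (M := MvPolynomial (Literature.NumberTheory.DiophantineGeometry.MatIdx m × Literature.NumberTheory.DiophantineGeometry.MatIdx m) ℂ))); Module.finrank ℂ ↥T < Literature.NumberTheory.DiophantineGeometry.orbitMultiplicity ℂ (Literature.NumberTheory.DiophantineGeometry.paddedPerFormLex ℂ n m) m χ) :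
    δ * (m - n) ≤ lam.parts.sup ∧ lam.parts.card ≤ n ^ 2 + 1 := by
  refine NoValuativeFlip.kadishLandsberg_of_hasHighestWeight_paddedPerOrbitRep hnm lam hcard ?_
  have hpos : 0 < orbitMultiplicity ℂ (paddedPerFormLex ℂ n m) m
      (Weight.dualOfPartition (m * m) lam).toMatIdx := lt_of_le_of_lt (Nat.zero_le _) hlt
  intro hbot
  change highestWeightSpace (orbitCoordRep (paddedPerFormLex ℂ n m) m)
    (Weight.dualOfPartition (m * m) lam).toMatIdx = ⊥ at hbot
  rw [orbitMultiplicity, hwMultiplicity, hbot, finrank_bot] at hpos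
  exact lt_irrefl 0 hpos

/-- **Flip witnesses sit strictly below Grenet's bound**: `m + 1 < 2ⁿ`. [Grenet 2011; this route] -/
theorem headFlip_witness_lt_two_pow {n : ℕ} (m : ℕ) [NeZero m]
    (U : Submodule ℂ (Literature.NumberTheory.DiophantineGeometry.MatIdx m → ℂ)) (r : ℕ)
    (hU : ∀ u ∈ U, (Matrix.of fun a b : Fin m => u (toLex (a, b))).rank ≤ r)
    (δ : ℕ) (lam : Nat.Partition (m * δ)) (hcard : lam.parts.card ≤ m * m)
    (hlt : let χ : Literature.NumberTheory.DiophantineGeometry.Weight (Literature.NumberTheory.DiophantineGeometry.MatIdx m) := (Literature.NumberTheory.DiophantineGeometry.Weight.dualOfPartition (m * m) lam).toMatIdx; let T : Submodule ℂ (MvPolynomial (Literature.NumberTheory.DiophantineGeometry.MatIdx m × Literature.NumberTheory.DiophantineGeometry.MatIdx m) ℂ) := MvPolynomial.homogeneousSubmodule (Literature.NumberTheory.DiophantineGeometry.MatIdx m × Literature.NumberTheory.DiophantineGeometry.MatIdx m) ℂ (m * δ) ⊓ ((MvPolynomial.vanishingIdeal ℂ {p : Literature.NumberTheory.DiophantineGeometry.MatIdx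 m × Literature.NumberTheory.DiophantineGeometry.MatIdx m → ℂ | ∀ j : Literature.NumberTheory.DiophantineGeometry.MatIdx m, (fun i => p (j, i)) ∈ U}) ^ (δ * (m - r))).restrictScalars ℂ ⊓ (⨅ (M : Matrix (Literature.NumberTheory.DiophantineGeometry.MatIdx m) (Literature.NumberTheory.DiophantineGeometry.MatIdx m) ℂ) (_ : Literature.Computability.AlgebraicComplexity.linSubst (Literature.NumberTheory.DiophantineGeometry.MatIdx m) ℂ M (Literature.NumberTheory.DiophantineGeometry.detFormLex ℂ m) = Literature.NumberTheory.DiophantineGeometry.detFormLex ℂ m), LinearMap.ker ((MvPolynomial.aeval (R := ℂ) fun p : Literature.NumberTheory.DiophantineGeometry.MatIdx m × Literature.NumberTheory.DiophantineGeometry.MatIdx m => ∑ l : Literature.NumberTheory.DiophantineGeometry.MatIdx m, M l p.2 • MvPolynomial.X (p.1, l)).toLinearMap - LinearMap.id (R := ℂ) (M := MvPolynomial (Literature.NumberTheory.DiophantineGeometry.MatIdx m × Literature.NumberTheory.DiophantineGeometry.MatIdx m) ℂ))) ⊓ (⨅ (g : Matrix.GeneralLinearGroup (Literature.NumberTheory.DiophantineGeometry.MatIdx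 m) ℂ) (_ : Literature.NumberTheory.DiophantineGeometry.IsUpperTriangular g), LinearMap.ker ((MvPolynomial.aeval (R := ℂ) fun p : Literature.NumberTheory.DiophantineGeometry.MatIdx m × Literature.NumberTheory.DiophantineGeometry.MatIdx m => ∑ l : Literature.NumberTheory.DiophantineGeometry.MatIdx m, ((g⁻¹ : Matrix.GeneralLinearGroup (Literature.NumberTheory.DiophantineGeometry.MatIdx m) ℂ) : Matrix (Literature.NumberTheory.DiophantineGeometry.MatIdx m) (Literature.NumberTheory.DiophantineGeometry.MatIdx m) ℂ) p.1 l • MvPolynomial.X (l, p.2)).toLinearMap - Literature.NumberTheory.DiophantineGeometry.weightChar χ g • LinearMap.id (R := ℂ) (M := MvPolynomial (Literature.NumberTheory.DiophantineGeometry.MatIdx m × Literature.NumberTheory.DiophantineGeometry.MatIdx m) ℂ))); Module.finrank ℂ ↥T < Literature.NumberTheory.DiophantineGeometry.orbitMultiplicity ℂ (Literature.NumberTheory.DiophantineGeometry.paddedPerFormLex ℂ n m) m χ) :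
    m + 1 < 2 ^ n := by
  by_contra hle
  exact (not_lt.mpr (NoValuativeFlip.noValuativeFlip_body_of_two_pow_le' m (not_lt.mp hle)
    U r hU δ lam hcard)) hlt

end Summit.ValiantsHypothesis.ValiantsHypothesis.Theorems.HeadFlip.Negative

end
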